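import Summits.BirchSwinnertonDyer.Rank1Residual.Additive.RamifiedSevenGenusFrameGaussSqrt
import HarnessLib

/-!
# K2C-14 (P3/4) — the ARITHMETIC INPUTS of a `𝒞₇` genus frame (`GenusSeven.GenusFrame`): the frame inputs §B, part 1 (`v` … `ω`)

Port (pen `bsd-cm` D1059) of the crux workfile `Cruxes/EllipticUnitValueSevenOfGZK/K2C14GenusFrameArithmeticInputs_g77.lean`
(commit e142b9ea3ae9, tree sha16 80281c1844350e71) by seat bsd-idea-20 g77; row K2C-14 (pen D1048).

Cell bsd-cm, seat bsd-idea-20 g77 (planner, crux-level, W-79 publish-only), crux `EllipticUnitValueSevenOfGZK`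
(stmt-BirchSwinnertonDyer-19945, route K7r `RamifiedSevenEllipticUnits`).  Specification = the K2C-11 inventory memo v3
`Cruxes/EllipticUnitValueSevenOfGZK/K2C11ConstructionInventory_g76.md` (tree 12ee9b0d407224ef) §1(b)/(c); row card
`pub/bsd-cm/bsd-cm-plan/g37/SUMMON-typers-K2C-13-16.md` (7e0dfdb9162e356c); pen rulings D1044 (C), D1045, D1048.

SPLIT (pen D1061; the tree's 400-line rule for files with proofs): the port is FOUR files with one namespace
`Summit.BirchSwinnertonDyer.Rank1Residual.Additive.GenusSeven.ArithmeticInputs` and a linear import chain —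
P1 `RamifiedSevenGenusFrameArithmeticKernels.lean` (§A1–A4), P2 `RamifiedSevenGenusFrameGaussSqrt.lean` (§A5),
P3 `RamifiedSevenGenusFrameArithmeticInputs.lean` (§B part 1: `v` … `ω`), P4 `RamifiedSevenGenusFrameArithmeticInputsEta.lean`
(§B part 2: `etaOne_isPrimitive`, `g`, `r`, `η₁`, the assembly check `mkGenusFrame`).  Content = commit e142b9ea3ae9 verbatim up to
the five D1059 edits (namespace, `set_option`, draft sentence) and this split.

THIS PART (P3) and P4 — §B THE FRAME INPUTS at `(p, level) = (7, |D|)` — field (FactorisationShape line) ↦ declaration here (hypotheses), each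
conclusion in the EXACT letter of the field (`D`-hypotheses: `hD : D < 0`, `hD4 : D % 4 = 1`, `hsq : Squarefree D`,
`h7 : ¬ 7 ∣ D`, instance `[NeZero D.natAbs]` (from `hD`); `hKL` the displayed named fact, for `g` only, as the row card says):
  `v`, `seven_mem_v` (l.113–114) ↦ `placeSeven`, `seven_mem_placeSeven` · `F₀`, `F₀_eq`, `F₀_le` (l.116–119) ↦ `F₀ D`,
  `F₀_eq` (rfl), `F₀_le (hD hD4 hsq)` · `ζsys`, `ζsys_compatible` (l.121–122) ↦ `ζsys D`, `ζsys_compatible (h7)` (ONE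
  root system: `Kato2004.primitiveRootUnit ℚ 7 (n+1) · ζ_{|D|}^{(7⁻¹ mod |D|)^{n+1}}`; `ζsys_pow_natAbs` = the sharing with
  `KummerFrame.ζ`) · `u`, `u_topGenerator` (l.124–125) ↦ `u` (`coe_u : u = 64`), `u_topGenerator` · `γ₀`,
  `cyclotomicCharacter_γ₀`, `γ₀_mem` (l.127–129) ↦ `γ₀ = σ₈²` (`cyclotomicCharacter_σ₈ : χ₇ σ₈ = 8`, `σ₈` trivial on
  prime-to-7 roots of unity), `cyclotomicCharacter_γ₀` (rfl), `γ₀_mem (hD hD4 hsq h7)` · `χD`, `χD_isPrimitive`, `χD_mul_self`,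
  `χD_neg_one` (l.131–134) ↦ `χD D = jacobiCharInt |D| ∘ (ℤ → ℤ₇)`, `χD_isPrimitive (hD4 hsq)`, `χD_mul_self`, `χD_neg_one (hD
  hD4)` · `ω`, `ω_teichmuller` (l.136–137) ↦ `ω = MulChar.ofUnitHom (Kato2004.teichmullerChar 7)`, `ω_teichmuller` ·
  `etaOne_isPrimitive` (l.141–142) ↦ `etaOne_isPrimitive (hD4 hsq h7)` (via `isPrimitive_mul_of_coprime_levels`) · `η₁`,
  `η₁_trivial`, `η₁_reading` (l.143–147) ↦ `η₁ D h7` (`= toUnitHom (χ_D ω⁵) ∘ galToPow`, `galToPow` = Mathlib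
  `IsPrimitiveRoot.autToPow` of `ζsys D 0` along `absoluteGaloisGroup.toAlgEquiv`), `η₁_trivial (hD hD4 hsq h7)`, `η₁_reading
  (h7)` · `g`, `g_spec` (l.148–150) ↦ `g D hKL hD4 hsq h7`, `g_spec` · `r`, `r_logTable` (l.153–154) ↦ `r`, `r_logTable`.
  NOT HERE: `D … normA_coprime` (road parameters l.102–111) and `U` (l.156–157, row K2C-13 ★).
  ASSEMBLY CHECK `mkGenusFrame D hD hD4 hsq h7 N hN hNc hKL U : GenusFrame` — the kernel's certificate that the §B
  declarations fill EVERY field l.113–154 in its exact letter (parameters and `U` as arguments); axioms of `mkGenusFrame`: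
  `propext, Classical.choice, Quot.sound`.


WHAT THIS FILE DOES.  For a discriminant `D` (`D < 0`, `D ≡ 1 (mod 4)`, squarefree, `7 ∤ D`) it CONSTRUCTS / PROVES, one
declaration per field and in the EXACT letter of the field (`RamifiedSevenGenusFactorisationShape.lean` l.101–157), every
field of `GenusSeven.GenusFrame` between `v` (l.113) and `r_logTable` (l.154) — i.e. everything except the road data
`D, normA` (parameters) and the semi-local datum `U` (l.156–157, row K2C-13 ★).  Namespace
`Summit.BirchSwinnertonDyer.Rank1Residual.Additive.GenusSeven.ArithmeticInputs`.

FINDINGS (boxed for the pen; none is a letter deviation):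
  ┌ (F1) `hKL`.  `g`/`g_spec` are the only declarations under the named fact `iwasawa_existsUnique_kubotaLeopoldtSeries`
  │      (row card: «displayed hypothesis hKL»); `genusFrameOf … (hKL) …` must thread it.  Everything else is unconditional.
  │ (F2) `[NeZero D.natAbs]`.  `χD`, `zetaLevel/ζsys`, `etaOne/galToPow/η₁`, `g` carry the instance binder (Mathlib's
  │      `jacobiCharInt`/`DirichletCharacter` API wants it); at the frame constructor: `haveI := ⟨Int.natAbs_ne_zero.mpr hD.ne⟩`.
  │      The field `g_spec : ∀ [NeZero D.natAbs], …` is then `g_spec D hKL hD4 hsq h7` (instances of a `Prop`-class agree).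
  │ (F3) ℚ-ALGEBRA DIAMOND on `ℚ̄`.  A freshly elaborated `ℚ̄ ≃ₐ[ℚ] ℚ̄` / `IntermediateField ℚ ℚ̄` picks Mathlib's
  │      `DivisionRing.toRatAlgebra`, while `absoluteGaloisGroup.toAlgEquiv ℚ σ` lands at `AlgebraicClosure.instAlgebra ℚ`; the two
  │      are DEFINITIONALLY equal but not at `instances` transparency: pass between them with `exact`/`Eq.trans`, never `rw`
  │      (see `η₁_trivial`, χ_D-part).  No statement is affected.
  │ (F4) `MulChar.ofUnitHom (f ^ n) = MulChar.ofUnitHom f ^ n` (`ofUnitHom_pow`) is not in Mathlib; 3 lines here.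
  └ (F5) `u = 64`, `χ₇(σ₈) = 8`, `γ₀ = σ₈²` exactly as the row card; `σ₈` is CHOSEN (surjectivity of `χ₇` + prime-to-7
         splitting, `Classical.choose`), so `γ₀`, `u`, `r`, `g` are noncomputable but closed terms.

HONEST LABEL: infrastructure (definitions + kernel lemmas); it closes no item, registers no stub, proves no summit
statement; stmt-BirchSwinnertonDyer-19945 is OPEN; `X12.CMRamifiedSeven` is NOT proved; BSD is claimed for no curve.
No `sorry`, no `instance`, no `notation`/`macro`, no named fact introduced, no attribute removed.

References: [Lang1990] S. Lang, Cyclotomic Fields I and II, Ch. 10 §1 (PDF p. 167: `γ`, `⟨a⟩ = γ^{α(a)}`, `r(a)`);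
[Tsuji1999] T. Tsuji, Semi-local units modulo cyclotomic units, J. Number Theory 78 (1999), §3–§4; [Washington1997]
L. Washington, Introduction to Cyclotomic Fields, Ch. 3–4 (conductors; Gauss sums, Lemma 4.7–4.8), Ch. 14 (p. 321);
[IrelandRosen1990] K. Ireland, M. Rosen, A Classical Introduction to Modern Number Theory, Ch. 6 §3 (the sign of the
quadratic Gauss sum squared, `g² = (−1)^{(p−1)/2} p`) and Ch. 13 §3; [Kato2004Asterisque] K. Kato, Astérisque 295, §15.5.
-/

noncomputable section

open scoped NumberField
open PowerSeries IsDedekindDomain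
open Literature.NumberTheory.EllipticCurves
open Literature.NumberTheory.EllipticCurves.IwasawaAlgebra
open Literature.NumberTheory.IwasawaTheory
open Literature.NumberTheory.IwasawaTheory.StickelbergerSeries
open Literature.NumberTheory.ComplexMultiplication.EllipticUnits

namespace Summit.BirchSwinnertonDyer.Rank1Residual.Additive.GenusSeven.ArithmeticInputs

/-! ## §B The frame inputs at `(p, level) = (7, |D|)` — one declaration per `GenusFrame` field (l.113–154), same names -/

section Frame

open Field Literature.NumberTheory.GaloisRepresentations Literature.NumberTheory.QuadraticFields
open Summit.BirchSwinnertonDyer.Rank1Residual.Additive.GenusSeven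

variable (D : ℤ)

/-! ### `v`, `seven_mem_v` (l.113–114) -/

/-- The place `7` of `ℚ` (Mathlib `Rat.HeightOneSpectrum.primesEquiv`). Field `v` (l.113). [cite: Tsuji1999, §3 (p. 5, «p an odd prime»)] -/
def placeSeven : HeightOneSpectrum (𝓞 ℚ) :=
  (Rat.HeightOneSpectrum.primesEquiv (R := 𝓞 ℚ)).symm ⟨7, Nat.prime_seven⟩

/-- `7 ∈ v` — the letter of field `seven_mem_v` (l.114). [cite: Tsuji1999, §3 (p. 5)] -/
theorem seven_mem_placeSeven : ((7 : ℕ) : 𝓞 ℚ) ∈ placeSeven.asIdeal :=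
  (natCast_mem_asIdeal_iff_eq_primesEquiv_symm placeSeven Nat.prime_seven).mpr rfl

/-! ### `F₀`, `F₀_eq`, `F₀_le` (l.116–119) -/

/-- `F₀ = ℚ(√D) ⊆ ℚ̄`. Field `F₀` (l.116). [cite: Tsuji1999, §3 (p. 5, «F»)] -/
def F₀ : IntermediateField ℚ (AlgebraicClosure ℚ) :=
  IntermediateField.adjoin ℚ {x : AlgebraicClosure ℚ | x ^ 2 = (D : AlgebraicClosure ℚ)}

/-- The letter of field `F₀_eq` (l.117). [cite: Tsuji1999, §3 (p. 5)] -/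
theorem F₀_eq : F₀ D = IntermediateField.adjoin ℚ {x : AlgebraicClosure ℚ | x ^ 2 = (D : AlgebraicClosure ℚ)} := rfl

/-- **`ℚ(√D) ⊆ ℚ(μ_{|D|})`** — the letter of field `F₀_le` (l.119), by §A5. [cite: Washington1997, Ch. 4 Lemma 4.8] -/
theorem F₀_le (hD : D < 0) (hD4 : D % 4 = 1) (hsq : Squarefree D) :
    F₀ D ≤ IntermediateField.adjoin ℚ {x : AlgebraicClosure ℚ | x ^ D.natAbs = 1} :=
  quadraticField_le_adjoin_rootsOfUnity hD hD4 hsq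

/-! ### `ζsys`, `ζsys_compatible` (l.121–122): ONE root system (`Kato2004.primitiveRootUnit ℚ 7` times a fixed `ζ_{|D|}`) -/

/-- A primitive `|D|`-th root of unity in `ℚ̄`. [cite: Washington1997, Ch. 2] -/
def zetaLevel [NeZero D.natAbs] : AlgebraicClosure ℚ :=
  (HasEnoughRootsOfUnity.exists_primitiveRoot (AlgebraicClosure ℚ) D.natAbs).choose

/-- `zetaLevel D` is a primitive `|D|`-th root of unity. [cite: Washington1997, Ch. 2] -/
theorem isPrimitiveRoot_zetaLevel [NeZero D.natAbs] : IsPrimitiveRoot (zetaLevel D) D.natAbs :=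
  (HasEnoughRootsOfUnity.exists_primitiveRoot (AlgebraicClosure ℚ) D.natAbs).choose_spec

/-- An inverse of `7` modulo `|D|`, as a natural number. [cite: Washington1997, Thm. 2.5 (CRT exponents)] -/
def invSeven : ℕ := ((7 : ZMod D.natAbs)⁻¹).val

/-- `invSeven D · 7 ≡ 1 (mod |D|)` for `7 ∤ D`. [cite: Washington1997, Thm. 2.5] -/
theorem invSeven_mul_seven_mod [NeZero D.natAbs] (h7 : ¬ (7 : ℤ) ∣ D) :
    (invSeven D * 7) % D.natAbs = 1 % D.natAbs := by
  have hcop : (7 : ℕ).Coprime D.natAbs :=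
    (Nat.Prime.coprime_iff_not_dvd Nat.prime_seven).mpr fun h => h7 (Int.ofNat_dvd_left.mpr h)
  have h1 : ((invSeven D * 7 : ℕ) : ZMod D.natAbs) = 1 := by
    rw [Nat.cast_mul, invSeven, ZMod.natCast_zmod_val, mul_comm]
    exact_mod_cast ZMod.coe_mul_inv_eq_one 7 hcop
  have h2 := congrArg ZMod.val h1
  rwa [ZMod.val_natCast, ZMod.val_one_eq_one_mod] at h2

/-- `invSeven D` is prime to `|D|` (for `7 ∤ D`). [cite: Washington1997, Thm. 2.5] -/
theorem invSeven_coprime [NeZero D.natAbs] (h7 : ¬ (7 : ℤ) ∣ D) : (invSeven D).Coprime D.natAbs :=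
  Nat.coprime_of_mul_modEq_one 7 (invSeven_mul_seven_mod D h7)

/-- **The compatible root system** `ζsys n = ζ_{7^{n+1}} · ζ_{|D|}^{(7⁻¹ mod |D|)^{n+1}}` (one `7`-power system —
`Kato2004.primitiveRootUnit ℚ 7` — for the whole file; no second root system). Field `ζsys` (l.121). [cite: Tsuji1999, §3 (p. 5, «ζ_{p^{n+1}}») and §5] -/
def ζsys [NeZero D.natAbs] (n : ℕ) : AlgebraicClosure ℚ :=
  ((Kato2004.primitiveRootUnit ℚ 7 (n + 1) : (AlgebraicClosure ℚ)ˣ) : AlgebraicClosure ℚ) *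
    zetaLevel D ^ (invSeven D ^ (n + 1))

/-- **`ζsys` is a compatible system of primitive `7^{n+1}|D|`-th roots of unity** — the letter of field
`ζsys_compatible` (l.122): primitivity = coprime orders `7^{n+1}` and `|D|` multiply; compatibility =
`ζ_{7^{n+2}}^7 = ζ_{7^{n+1}}` and `7·7⁻¹ ≡ 1 (mod |D|)`. [cite: Tsuji1999, §3 (p. 5) and §5 (p. 14)] [cite: Washington1997, Thm. 2.5] -/
theorem ζsys_compatible [NeZero D.natAbs] (h7 : ¬ (7 : ℤ) ∣ D) :
    CyclotomicUnits.IsCompatibleRootSystem D.natAbs 7 (ζsys D) := by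
  have hcop : (7 : ℕ).Coprime D.natAbs :=
    (Nat.Prime.coprime_iff_not_dvd Nat.prime_seven).mpr fun h => h7 (Int.ofNat_dvd_left.mpr h)
  have hζD : ∀ n : ℕ, IsPrimitiveRoot (zetaLevel D ^ (invSeven D ^ (n + 1))) D.natAbs := fun n =>
    (isPrimitiveRoot_zetaLevel D).pow_of_coprime _ ((invSeven_coprime D h7).pow_left _)
  refine ⟨fun n => ?_, fun n => ?_⟩
  · have hx : IsPrimitiveRoot ((Kato2004.primitiveRootUnit ℚ 7 (n + 1) : (AlgebraicClosure ℚ)ˣ) : AlgebraicClosure ℚ)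
        (7 ^ (n + 1)) := IsPrimitiveRoot.coe_units_iff.mpr (Kato2004.isPrimitiveRoot_primitiveRootUnit ℚ 7 (n + 1))
    have hy := hζD n
    have hco : (orderOf ((Kato2004.primitiveRootUnit ℚ 7 (n + 1) : (AlgebraicClosure ℚ)ˣ) : AlgebraicClosure ℚ)).Coprime
        (orderOf (zetaLevel D ^ (invSeven D ^ (n + 1)))) := by
      rw [← hx.eq_orderOf, ← hy.eq_orderOf]; exact hcop.pow_left _
    have hord := Commute.orderOf_mul_eq_mul_orderOf_of_coprime (Commute.all _ _) hco
    rw [← hx.eq_orderOf, ← hy.eq_orderOf] at hord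
    show IsPrimitiveRoot (((Kato2004.primitiveRootUnit ℚ 7 (n + 1) : (AlgebraicClosure ℚ)ˣ) : AlgebraicClosure ℚ) *
      zetaLevel D ^ (invSeven D ^ (n + 1))) (7 ^ (n + 1) * D.natAbs)
    rw [← hord]
    exact IsPrimitiveRoot.orderOf _
  · have hz : zetaLevel D ^ D.natAbs = 1 := (isPrimitiveRoot_zetaLevel D).pow_eq_one
    show (((Kato2004.primitiveRootUnit ℚ 7 (n + 1 + 1) : (AlgebraicClosure ℚ)ˣ) : AlgebraicClosure ℚ) *
        zetaLevel D ^ (invSeven D ^ (n + 1 + 1))) ^ 7 =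
      ((Kato2004.primitiveRootUnit ℚ 7 (n + 1) : (AlgebraicClosure ℚ)ˣ) : AlgebraicClosure ℚ) *
        zetaLevel D ^ (invSeven D ^ (n + 1))
    rw [mul_pow, ← Units.val_pow_eq_pow_val, Kato2004.primitiveRootUnit_succ_pow, ← pow_mul]
    congr 1
    rw [pow_eq_pow_mod _ hz, pow_eq_pow_mod (invSeven D ^ (n + 1)) hz, pow_succ (invSeven D) (n + 1), mul_assoc,
      Nat.mul_mod, invSeven_mul_seven_mod D h7, ← Nat.mul_mod, mul_one]

/-- **Sharing with `KummerFrame.ζ`**: `(ζsys n)^{|D|} = ζ_{7^{n+1}}^{|D|}` with `ζ_{7^{n+1}} = Kato2004.primitiveRootUnit ℚ 7 (n+1)`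
(the `7`-power part of `ζsys` IS the Kummer-frame root system). [cite: Kato2004Asterisque, §15.5 (p. 253)] [cite: Tsuji1999, p. 3 (Notation)] -/
theorem ζsys_pow_natAbs [NeZero D.natAbs] (n : ℕ) :
    ζsys D n ^ D.natAbs =
      ((Kato2004.primitiveRootUnit ℚ 7 (n + 1) : (AlgebraicClosure ℚ)ˣ) : AlgebraicClosure ℚ) ^ D.natAbs := by
  show (((Kato2004.primitiveRootUnit ℚ 7 (n + 1) : (AlgebraicClosure ℚ)ˣ) : AlgebraicClosure ℚ) *
      zetaLevel D ^ (invSeven D ^ (n + 1))) ^ D.natAbs = _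
  rw [mul_pow, ← pow_mul, mul_comm (invSeven D ^ (n + 1)) D.natAbs, pow_mul, (isPrimitiveRoot_zetaLevel D).pow_eq_one,
    one_pow, mul_one]

/-- `ζsys D 0` is a primitive `|D|·7`-th root of unity (the level of `η₁`). [cite: Tsuji1999, §4 (p. 12, «χ a character of Gal(ℚ(μ_{fp})/ℚ)»)] -/
theorem isPrimitiveRoot_ζsys_zero [NeZero D.natAbs] (h7 : ¬ (7 : ℤ) ∣ D) :
    IsPrimitiveRoot (ζsys D 0) (D.natAbs * 7) := by
  have := (ζsys_compatible D h7).1 0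
  rwa [zero_add, pow_one, mul_comm] at this

/-! ### `u`, `u_topGenerator`, `γ₀`, `cyclotomicCharacter_γ₀`, `γ₀_mem` (l.124–129): `γ₀ = σ₈²`, `u = χ₇(γ₀) = 64` -/

/-- `8 ∈ ℤ₇^×`. [cite: Lang1990, Ch. 10 §1 (PDF p. 167)] -/
theorem isUnit_eight : IsUnit (8 : ℤ_[7]) := by
  rw [PadicInt.isUnit_iff]
  refine le_antisymm (PadicInt.norm_le_one _) (not_lt.mp fun h => ?_)
  have h' := (PadicInt.norm_int_lt_one_iff_dvd (p := 7) 8).mp (by exact_mod_cast h)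
  revert h'; norm_num

/-- The unit `8` of `ℤ₇`. [cite: Lang1990, Ch. 10 §1 (PDF p. 167)] -/
def unitEight : ℤ_[7]ˣ := isUnit_eight.unit

/-- `(unitEight : ℤ₇) = 8`. [cite: Lang1990, Ch. 10 §1] -/
theorem coe_unitEight : (unitEight : ℤ_[7]) = 8 := isUnit_eight.unit_spec

/-- Every cyclotomic polynomial is irreducible over `ℚ` (Mathlib), in the toolkit's shape. [cite: Washington1997, Thm. 2.5] -/
theorem cyclotomic_irreducible : ∀ n : ℕ, 0 < n → Irreducible (Polynomial.cyclotomic n ℚ) :=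
  fun _ hn => Polynomial.cyclotomic.irreducible_rat hn

/-- **`σ₈ ∈ Γ_ℚ`**: an automorphism with `χ₇(σ₈) = 8` acting TRIVIALLY on every root of unity of order prime to `7`
(surjectivity of `χ₇`, `GaloisRep.cyclotomicCharacter_surjective`, then splitting off the prime-to-`7` part,
`RootOfUnityAction.exists_smul_eq_smul_and_smul_eq_self`). [cite: Washington1997, Ch. 14 (p. 321, `Gal(ℚ(μ_∞)/ℚ) ≅ ∏ ℤ_p^×`)] -/
def σ₈ : absoluteGaloisGroup ℚ :=
  (RootOfUnityAction.exists_smul_eq_smul_and_smul_eq_self (K := ℚ) cyclotomic_irreducible Nat.prime_seven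
    (GaloisRep.cyclotomicCharacter_surjective ℚ 7 cyclotomic_irreducible unitEight).choose).choose

/-- `χ₇(σ₈) = 8`. [cite: Washington1997, Ch. 14 (p. 321)] -/
theorem cyclotomicCharacter_σ₈ : GaloisRep.cyclotomicCharacter ℚ 7 σ₈ = unitEight := by
  rw [← (GaloisRep.cyclotomicCharacter_surjective ℚ 7 cyclotomic_irreducible unitEight).choose_spec]
  exact cyclotomicCharacter_eq_of_forall_smul_eq
    (RootOfUnityAction.exists_smul_eq_smul_and_smul_eq_self (K := ℚ) cyclotomic_irreducible Nat.prime_seven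
      (GaloisRep.cyclotomicCharacter_surjective ℚ 7 cyclotomic_irreducible unitEight).choose).choose_spec.1

/-- `σ₈` fixes every root of unity of order prime to `7`. [cite: Washington1997, Ch. 14 (p. 321)] -/
theorem σ₈_smul_eq_self {m : ℕ} (hm : (7 : ℕ).Coprime m) (ζ : AlgebraicClosure ℚ) (hζ : ζ ^ m = 1) : σ₈ • ζ = ζ :=
  (RootOfUnityAction.exists_smul_eq_smul_and_smul_eq_self (K := ℚ) cyclotomic_irreducible Nat.prime_seven
    (GaloisRep.cyclotomicCharacter_surjective ℚ 7 cyclotomic_irreducible unitEight).choose).choose_spec.2 m hm ζ hζ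

/-- **`γ₀ = σ₈²`** — field `γ₀` (l.127). [cite: Tsuji1999, §3 (p. 6, «γ a topological generator of Gal(K_∞/K)», «T = γ − 1»)] -/
def γ₀ : absoluteGaloisGroup ℚ := σ₈ ^ 2

/-- **`u = χ₇(γ₀)`** — field `u` (l.124); so `cyclotomicCharacter_γ₀` (l.128) holds by `rfl`. [cite: Tsuji1999, §3 (p. 6, «κ(γ₀) = u»)] -/
def u : ℤ_[7]ˣ := GaloisRep.cyclotomicCharacter ℚ 7 γ₀

/-- The letter of field `cyclotomicCharacter_γ₀` (l.128). [cite: Tsuji1999, §3 (p. 6)] -/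
theorem cyclotomicCharacter_γ₀ : GaloisRep.cyclotomicCharacter ℚ 7 γ₀ = u := rfl

/-- `u = 64 = 8²`. [cite: Lang1990, Ch. 10 §1 (PDF p. 167, «γ = 1 + p is a topological generator … any u ≡ 1 mod p, u ≢ 1 mod p²»)] -/
theorem coe_u : (u : ℤ_[7]) = 64 := by
  rw [u, γ₀, map_pow, cyclotomicCharacter_σ₈, Units.val_pow_eq_pow_val, coe_unitEight]; norm_num

/-- **`u = 64` is a topological generator of `1 + 7ℤ₇`** (`‖64 − 1‖ = ‖7·9‖ = 7⁻¹`) — the letter of field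
`u_topGenerator` (l.125). [cite: Lang1990, Ch. 10 §1 (PDF p. 167)] -/
theorem u_topGenerator : KubotaLeopoldt.IsTopGenerator 7 (u : ℤ_[7]) := by
  rw [KubotaLeopoldt.IsTopGenerator, coe_u, show (64 : ℤ_[7]) - 1 = 7 * 9 by norm_num, norm_mul]
  have h7 : ‖(7 : ℤ_[7])‖ = ((7 : ℕ) : ℝ)⁻¹ := by exact_mod_cast PadicInt.norm_p (p := 7)
  have h9 : ‖(9 : ℤ_[7])‖ = 1 := by
    refine le_antisymm (PadicInt.norm_le_one _) (not_lt.mp fun h => ?_)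
    have h' := (PadicInt.norm_int_lt_one_iff_dvd (p := 7) 9).mp (by exact_mod_cast h)
    revert h'; norm_num
  rw [h7, h9, mul_one]

/-- **`γ₀` fixes `K_0 = F₀(μ₇)` pointwise** — the letter of field `γ₀_mem` (l.129): `σ₈` fixes `μ_{|D|} ⊇` generators
of `F₀` (by `F₀_le`), and `γ₀` acts on `μ₇` by `64 ≡ 1 (mod 7)`. [cite: Tsuji1999, §3 (p. 6)] [cite: Washington1997, Ch. 14 (p. 321)] -/
theorem γ₀_mem (hD : D < 0) (hD4 : D % 4 = 1) (hsq : Squarefree D) (h7 : ¬ (7 : ℤ) ∣ D) :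
    γ₀ ∈ fixingSubgroupQ (cyclotomicLayer (F₀ D) 7 0) := by
  haveI : NeZero (7 : ℕ) := ⟨by norm_num⟩
  have hcop : (7 : ℕ).Coprime D.natAbs :=
    (Nat.Prime.coprime_iff_not_dvd Nat.prime_seven).mpr fun h => h7 (Int.ofNat_dvd_left.mpr h)
  rw [mem_fixingSubgroupQ_iff]
  intro x hx
  rw [← absoluteGaloisGroup.smul_def]
  have hS : ∀ ζ ∈ {x : AlgebraicClosure ℚ | x ^ D.natAbs = 1}, γ₀ • ζ = (1 : absoluteGaloisGroup ℚ) • ζ := by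
    intro ζ hζ
    rw [one_smul, γ₀, pow_two, mul_smul, σ₈_smul_eq_self hcop ζ hζ, σ₈_smul_eq_self hcop ζ hζ]
  have hT : ∀ ζ ∈ {x : AlgebraicClosure ℚ | x ^ 7 ^ (0 + 1) = 1}, γ₀ • ζ = (1 : absoluteGaloisGroup ℚ) • ζ := by
    intro ζ hζ
    rw [one_smul, GaloisRep.cyclotomicCharacter_spec ℚ 7 (k := 0 + 1) γ₀ ζ hζ, cyclotomicCharacter_γ₀, coe_u]
    have hval : ((PadicInt.toZModPow (0 + 1)) (64 : ℤ_[7])).val = 1 := by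
      rw [show (64 : ℤ_[7]) = ((64 : ℕ) : ℤ_[7]) by norm_cast, map_natCast, ZMod.val_natCast]; norm_num
    rw [hval, pow_one]
  have key := forall_smul_eq_of_le_sup_adjoin (σ := γ₀) (τ := 1) (F₀_le D hD hD4 hsq) hS hT x hx
  rwa [one_smul] at key

/-! ### `χD`, `χD_isPrimitive`, `χD_mul_self`, `χD_neg_one` (l.131–134): the Kronecker character, `ℤ₇`-valued -/

/-- **`χ_D = (· | |D|)`**, the Kronecker/Jacobi character mod `|D|` with values in `ℤ₇` (tree `jacobiCharInt`). Field `χD` (l.131). [cite: Cox2013, §1.C Lemma 1.14] -/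
def χD [NeZero D.natAbs] : DirichletCharacter ℤ_[7] D.natAbs :=
  (jacobiCharInt D.natAbs).ringHomComp (Int.castRingHom ℤ_[7])

/-- Values of `χD`. [cite: Cox2013, §1.C Lemma 1.14] -/
theorem χD_apply [NeZero D.natAbs] (a : ZMod D.natAbs) : χD D a = ((jacobiCharInt D.natAbs a : ℤ) : ℤ_[7]) := rfl

/-- **`χ_D` is primitive mod `|D|`** — the letter of field `χD_isPrimitive` (l.132) (tree `isPrimitive_jacobiChar` for odd
squarefree `|D|`, transported along the injections `ℤ → ℂ`, `ℤ → ℤ₇`). [cite: MontgomeryVaughan2007, Theorem 9.13] -/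
theorem χD_isPrimitive [NeZero D.natAbs] (hD4 : D % 4 = 1) (hsq : Squarefree D) : (χD D).IsPrimitive := by
  have hodd : Odd D.natAbs := by rw [Int.natAbs_odd]; exact Int.odd_iff.mpr (by omega)
  have h1 : (jacobiCharInt D.natAbs).IsPrimitive := by
    have h := isPrimitive_jacobiChar hodd (Int.squarefree_natAbs.mpr hsq)
    rw [← jacobiCharInt_ringHomComp] at h
    exact (Kato2004.LayerCharacterTwo.isPrimitive_ringHomComp_iff _ (Int.castRingHom ℂ).injective_int).mp h
  exact (Kato2004.LayerCharacterTwo.isPrimitive_ringHomComp_iff _ (Int.castRingHom ℤ_[7]).injective_int).mpr h1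

/-- **`χ_D² = 1`** — the letter of field `χD_mul_self` (l.133). [cite: Cox2013, §1.C Lemma 1.14] -/
theorem χD_mul_self [NeZero D.natAbs] : χD D * χD D = 1 := by
  rw [← pow_two]; exact (isQuadratic_jacobiCharInt.comp _).sq_eq_one

/-- **`χ_D(−1) = −1`** (`|D| ≡ 3 (mod 4)`) — the letter of field `χD_neg_one` (l.134). [cite: Cox2013, §1.C Lemma 1.14] -/
theorem χD_neg_one [NeZero D.natAbs] (hD : D < 0) (hD4 : D % 4 = 1) : χD D (-1) = -1 := by
  have hodd : Odd D.natAbs := by rw [Int.natAbs_odd]; exact Int.odd_iff.mpr (by omega)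
  rw [χD_apply, jacobiCharInt_neg_one hodd, ZMod.χ₄_nat_three_mod_four (by omega)]
  push_cast
  rfl

/-! ### `ω`, `ω_teichmuller` (l.136–137): the tree's Teichmüller character -/

/-- **`ω = Kato2004.teichmullerChar 7`** read as a Dirichlet character mod `7`. Field `ω` (l.136). [cite: Lang1990, Ch. 2 §2 Thm. 2.5] -/
def ω : DirichletCharacter ℤ_[7] 7 := MulChar.ofUnitHom (Kato2004.teichmullerChar 7)

/-- The letter of field `ω_teichmuller` (l.137) (tree `toZMod_ofUnitHom_teichmullerChar`). [cite: Lang1990, Ch. 2 §2 Thm. 2.5] -/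
theorem ω_teichmuller : IsTeichmullerCharacter 7 ω := fun a =>
  Literature.NumberTheory.Congruences.TeichmullerTwist.toZMod_ofUnitHom_teichmullerChar (p := 7) a

/-- `MulChar.ofUnitHom` commutes with powers. [cite: Lang1990, Ch. 1 §2] -/
theorem ofUnitHom_pow {R R' : Type*} [CommMonoid R] [CommMonoidWithZero R'] (f : Rˣ →* R'ˣ) (n : ℕ) :
    MulChar.ofUnitHom (f ^ n) = MulChar.ofUnitHom f ^ n := by
  refine MulChar.ext fun a => ?_
  simp only [MulChar.pow_apply_coe, MulChar.ofUnitHom_coe, MonoidHom.pow_apply, Units.val_pow_eq_pow_val]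

/-- `ω⁵ ≠ 1` (tree `ofUnitHom_teichmullerChar_pow_ne_one`). [cite: Lang1990, Ch. 2 §2] -/
theorem ω_pow_five_ne_one : ω ^ 5 ≠ 1 := by
  rw [ω, ← ofUnitHom_pow]
  exact Literature.NumberTheory.GaussSums.ofUnitHom_teichmullerChar_pow_ne_one 7 (by norm_num) (by norm_num)

/-- `ω⁵` is primitive mod `7` (prime level, non-trivial). [cite: Washington1997, Ch. 3 (conductors)] -/
theorem isPrimitive_ω_pow_five : (ω ^ 5).IsPrimitive := by
  rw [DirichletCharacter.isPrimitive_def]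
  rcases (Nat.dvd_prime Nat.prime_seven).mp (DirichletCharacter.conductor_dvd_level (ω ^ 5)) with h | h
  · exact absurd (DirichletCharacter.eq_one_iff_conductor_eq_one.mpr h) ω_pow_five_ne_one
  · exact h

end Frame

end Summit.BirchSwinnertonDyer.Rank1Residual.Additive.GenusSeven.ArithmeticInputs

end
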